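import Literature.AnabelianGeometry.EtaleTheta.EtaleThetaClass
import Literature.AnabelianGeometry.EtaleTheta.Discharge.Sec2ClassTwoCommutators
import Mathlib.GroupTheory.SpecificGroups.Dihedral
import HarnessLib

/-!
# [EtTh] §1: `Δ_Θ ≠ 1` follows from "`Δ_X` is a profinite free group on 2 generators" — the vacuity
# guard `IsEtThOrigin` is equivalent to its first field

Mochizuki, *The étale theta function …*, Publ. RIMS **45** (2009), §1, PRIMS PDF p. 12 (printed 238)
[cite: MochizukiEtTh2009, §1 p.12]: "Since `Δ_X` is a profinite free group on 2 generators, we also have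
a natural exact sequence `1 → ∧² Δ^ell_X (≅ Ẑ(1)) → Δ^Θ_X → Δ^ell_X → 1`". Layer L2 of the abc-iut cell,
seat abc-iut-L2-t1. PROOF-ONLY companion (no `def`) of the root `Setting.lean` (vacuity guard
`ThetaSetting.IsEtThOrigin = ⟨deltaHat_free, deltaTheta_ne_bot⟩`).

PROVED: `ThetaSetting.deltaTheta_ne_bot_of_free` — if `Δ_X = D.DeltaHat` is profinite free on two
generators, then `Δ_Θ = Ker((Π^tp_X)^Θ ↠ (Π^tp_X)^ell) ≠ 1`; hence `IsEtThOrigin.of_free` and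
`isEtThOrigin_iff_free : D.IsEtThOrigin ↔ IsFreeProfiniteOnTwo D.DeltaHat` — the guard carries exactly
the one printed hypothesis. Argument: a free profinite group on `a, b` maps continuously onto the
dihedral group of order `8` (class `2`, `[r, s] ≠ 1` central) with `a ↦ r`, `b ↦ s`; by density of
`Δ^tp_X` in `Δ_X` there are `g, h ∈ Δ^tp_X` over `r`, `s`; then `[g, h]` lies in the pull-back of
`[Δ_X, Δ_X]⁻` (so its image in `(Π^tp_X)^Θ` lies in `Δ_Θ`, root axiom `ker_toEll`) but not in the
pull-back of `[[Δ_X, Δ_X], Δ_X]⁻ = Ker(Π^tp_X ↠ (Π^tp_X)^Θ)` (root axiom `ker_toTheta`), since its image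
`[r, s]` in the dihedral group is `≠ 1` while every double commutator there is trivial.
`exists_hom_finite_of_free` generalises abc-iut-L5-t14's `IsEtThOrigin.exists_hom_finite`
(`Discharge/Sec2ThetaGroupCommutators.lean`) to the bare freeness hypothesis and keeps the open fibres
(proof adapted verbatim). HONEST FRAMING: nothing of [EtTh] is asserted; no side is taken on any
disputed claim.
-/

namespace Literature.AnabelianGeometry.EtaleTheta

open Literature.AnabelianGeometry.SemiGraphs ClassTwo
open _root_.Topology
open scoped commutatorElement

/-! ### The dihedral group of order `8` is nonabelian of class `2` -/

/-- In the dihedral group of order `8` every commutator is central. [folklore] -/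
private theorem dihedral_four_commutator_central :
    ∀ g₁ g₂ g : DihedralGroup 4,
      g * (g₁ * g₂ * g₁⁻¹ * g₂⁻¹) = g₁ * g₂ * g₁⁻¹ * g₂⁻¹ * g := by
  decide

/-- In the dihedral group of order `8`, `[r, s] ≠ 1`. [folklore] -/
private theorem dihedral_four_commutator_ne_one :
    (DihedralGroup.r 1 * DihedralGroup.sr 0 * (DihedralGroup.r 1)⁻¹ * (DihedralGroup.sr 0)⁻¹ :
      DihedralGroup 4) ≠ 1 := by
  decide

/-- The double commutator subgroup of the dihedral group of order `8` is trivial (class `2`).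
[folklore] -/
private theorem dihedral_four_doubleCommutator_eq_bot :
    (⁅⁅(⊤ : Subgroup (DihedralGroup 4)), (⊤ : Subgroup (DihedralGroup 4))⁆,
      (⊤ : Subgroup (DihedralGroup 4))⁆ : Subgroup (DihedralGroup 4)) = ⊥ := by
  have hcen : (⁅(⊤ : Subgroup (DihedralGroup 4)), (⊤ : Subgroup (DihedralGroup 4))⁆ :
      Subgroup (DihedralGroup 4)) ≤ Subgroup.center (DihedralGroup 4) := by
    rw [Subgroup.commutator_le]
    intro g₁ _ g₂ _
    rw [Subgroup.mem_center_iff]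
    intro g
    rw [commutatorElement_def]
    exact dihedral_four_commutator_central g₁ g₂ g
  rw [eq_bot_iff, Subgroup.commutator_le]
  intro u hu g _
  have hu' := Subgroup.mem_center_iff.1 (hcen hu) g
  rw [Subgroup.mem_bot, commutatorElement_def, ← hu', mul_inv_cancel_right, mul_inv_cancel]

namespace ThetaSetting

variable {p : ℕ} [Fact p.Prime] (D : ThetaSetting p)

/-! ### A continuous homomorphism from `Δ_X` onto prescribed elements of a finite group -/

/-- "`Δ_X` is a profinite free group on 2 generators" (p. 12) supplies, for every FINITE group `Q` and
`x, y ∈ Q`, a homomorphism `F : Δ_X → Q` with open fibres and `F a = x`, `F b = y` for some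
`a, b ∈ Δ_X`, carrying the CLOSED double-commutator subgroup `[[Δ_X,Δ_X],Δ_X]⁻` into `[[Q,Q],Q]`
(generalises abc-iut-L5-t14's `IsEtThOrigin.exists_hom_finite` to the bare freeness hypothesis; proof
adapted from it). [cite: MochizukiEtTh2009, §1 p.12] -/
theorem exists_hom_finite_of_free (hfree : IsFreeProfiniteOnTwo D.DeltaHat) (Q : Type) [Group Q]
    [Finite Q] (x y : Q) :
    ∃ (F : D.DeltaHat →* Q) (a b : D.DeltaHat), F a = x ∧ F b = y ∧
      (∀ q : Q, IsOpen (F ⁻¹' {q})) ∧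
      (∀ g : D.DeltaHat,
        (g : D.PiHat) ∈ (⁅⁅D.DeltaHat, D.DeltaHat⁆, D.DeltaHat⁆).topologicalClosure →
          F g ∈ (⁅⁅(⊤ : Subgroup Q), (⊤ : Subgroup Q)⁆, (⊤ : Subgroup Q)⁆ : Subgroup Q)) := by
  obtain ⟨_, _, _, a, b, huniv⟩ := hfree
  letI : TopologicalSpace Q := ⊥
  haveI : DiscreteTopology Q := ⟨rfl⟩
  obtain ⟨f, ⟨hfa, hfb⟩, -⟩ := huniv Q x y
  have hΔclosed : IsClosed (D.DeltaHat : Set D.PiHat) := Subgroup.isClosed_topologicalClosure _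
  have hfc : Continuous f.toMonoidHom := f.continuous_toFun
  -- `[Δ_X, Δ_X]⁻ ⊆ f⁻¹ [Q, Q]`
  have h2 : (⁅D.DeltaHat, D.DeltaHat⁆).topologicalClosure ≤
      ((⁅(⊤ : Subgroup Q), (⊤ : Subgroup Q)⁆ : Subgroup Q).comap f.toMonoidHom).map
        D.DeltaHat.subtype := by
    refine Subgroup.topologicalClosure_minimal _ (Subgroup.commutator_le.mpr ?_)
      (isClosed_map_subtype_comap hΔclosed f.toMonoidHom hfc _)
    intro g₁ hg₁ g₂ hg₂
    refine ⟨⁅(⟨g₁, hg₁⟩ : D.DeltaHat), ⟨g₂, hg₂⟩⁆, ?_, rfl⟩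
    rw [SetLike.mem_coe, Subgroup.mem_comap, map_commutatorElement]
    exact Subgroup.commutator_mem_commutator (Subgroup.mem_top (f.toMonoidHom ⟨g₁, hg₁⟩))
      (Subgroup.mem_top (f.toMonoidHom ⟨g₂, hg₂⟩))
  have h2' : ∀ g : D.DeltaHat, (g : D.PiHat) ∈ (⁅D.DeltaHat, D.DeltaHat⁆).topologicalClosure →
      f.toMonoidHom g ∈ (⁅(⊤ : Subgroup Q), (⊤ : Subgroup Q)⁆ : Subgroup Q) :=
    fun g hg => mem_of_coe_mem_map_subtype_comap f.toMonoidHom _ (h2 hg)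
  -- `[[Δ_X, Δ_X], Δ_X]⁻ ⊆ f⁻¹ [[Q, Q], Q]`
  have h3 : (⁅⁅D.DeltaHat, D.DeltaHat⁆, D.DeltaHat⁆).topologicalClosure ≤
      ((⁅⁅(⊤ : Subgroup Q), (⊤ : Subgroup Q)⁆, (⊤ : Subgroup Q)⁆ : Subgroup Q).comap
        f.toMonoidHom).map D.DeltaHat.subtype := by
    refine Subgroup.topologicalClosure_minimal _ (Subgroup.commutator_le.mpr ?_)
      (isClosed_map_subtype_comap hΔclosed f.toMonoidHom hfc _)
    intro c hc g hg
    have hc' : c ∈ D.DeltaHat := D.commutatorClosure_le_deltaHat (Subgroup.le_topologicalClosure _ hc)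
    refine ⟨⁅(⟨c, hc'⟩ : D.DeltaHat), ⟨g, hg⟩⁆, ?_, rfl⟩
    rw [SetLike.mem_coe, Subgroup.mem_comap, map_commutatorElement]
    exact Subgroup.commutator_mem_commutator
      (h2' ⟨c, hc'⟩ (Subgroup.le_topologicalClosure _ hc)) (Subgroup.mem_top (f.toMonoidHom ⟨g, hg⟩))
  refine ⟨f.toMonoidHom, a, b, hfa, hfb, fun q => (isOpen_discrete {q}).preimage hfc, fun g hg => ?_⟩
  exact mem_of_coe_mem_map_subtype_comap f.toMonoidHom _ (h3 hg)

/-- Density of `Δ^tp_X` in `Δ_X = (Δ^tp_X)⁻ ⊆ Π_X` (p. 12 "the `∧` denotes the profinite completion"):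
a function on `Δ_X` with open fibres takes each of its values at (the image of) an element of `Δ^tp_X`.
[cite: MochizukiEtTh2009, §1 p.12] -/
theorem exists_mem_deltaTemp_apply_eq {Q : Type} (F : D.DeltaHat → Q)
    (hF : ∀ q : Q, IsOpen (F ⁻¹' {q})) (a : D.DeltaHat) :
    ∃ (g : D.PiTemp) (hg : g ∈ D.DeltaTemp),
      F ⟨D.toHat.toMonoidHom g, Subgroup.le_topologicalClosure _ ⟨g, hg, rfl⟩⟩ = F a := by
  obtain ⟨V, hV, hUV⟩ := isOpen_induced_iff.mp (hF (F a))
  have haV : (a : D.PiHat) ∈ V := by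
    have ha : a ∈ F ⁻¹' {F a} := rfl
    rw [← hUV] at ha
    exact ha
  have hcl : (a : D.PiHat) ∈
      closure ((D.DeltaTemp.map D.toHat.toMonoidHom : Subgroup D.PiHat) : Set D.PiHat) := by
    rw [← Subgroup.topologicalClosure_coe]
    exact a.2
  obtain ⟨z, hzV, ⟨g, hg, rfl⟩⟩ := mem_closure_iff.mp hcl V hV haV
  refine ⟨g, hg, ?_⟩
  have hz : (⟨D.toHat.toMonoidHom g, Subgroup.le_topologicalClosure _ ⟨g, hg, rfl⟩⟩ : D.DeltaHat) ∈
      F ⁻¹' {F a} := by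
    rw [← hUV]
    exact hzV
  exact hz

/-! ### `Δ_Θ ≠ 1` from freeness; the guard `IsEtThOrigin` from its first field -/

/-- **`Δ_Θ ≠ 1` whenever `Δ_X` is a profinite free group on `2` generators** (p. 12: "we also have a
natural exact sequence `1 → ∧² Δ^ell_X (≅ Ẑ(1)) → Δ^Θ_X → Δ^ell_X → 1`"): the second field of the
vacuity guard `IsEtThOrigin` is a CONSEQUENCE of the first. [cite: MochizukiEtTh2009, §1 p.12] -/
theorem deltaTheta_ne_bot_of_free (hfree : IsFreeProfiniteOnTwo D.DeltaHat) : D.DeltaTheta ≠ ⊥ := by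
  obtain ⟨F, a, b, hFa, hFb, hopen, h3⟩ :=
    D.exists_hom_finite_of_free hfree (DihedralGroup 4) (DihedralGroup.r 1) (DihedralGroup.sr 0)
  obtain ⟨g, hg, hFg⟩ := D.exists_mem_deltaTemp_apply_eq F hopen a
  obtain ⟨h, hh, hFh⟩ := D.exists_mem_deltaTemp_apply_eq F hopen b
  rw [hFa] at hFg
  rw [hFb] at hFh
  have hιg : D.toHat.toMonoidHom g ∈ D.DeltaHat := Subgroup.le_topologicalClosure _ ⟨g, hg, rfl⟩
  have hιh : D.toHat.toMonoidHom h ∈ D.DeltaHat := Subgroup.le_topologicalClosure _ ⟨h, hh, rfl⟩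
  have hιc : D.toHat.toMonoidHom ⁅g, h⁆ ∈ D.DeltaHat := by
    rw [map_commutatorElement, commutatorElement_def]
    exact D.DeltaHat.mul_mem (D.DeltaHat.mul_mem (D.DeltaHat.mul_mem hιg hιh)
      (D.DeltaHat.inv_mem hιg)) (D.DeltaHat.inv_mem hιh)
  -- `θ [g, h] ∈ Δ_Θ`: `[g, h] ∈ Ker(Π^tp_X ↠ (Π^tp_X)^ell) = ι⁻¹ [Δ_X, Δ_X]⁻`
  have hc_ell : D.toTheta ⁅g, h⁆ ∈ D.DeltaTheta := by
    change ⁅g, h⁆ ∈ (D.thetaToEll.comp D.toTheta).ker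
    rw [D.ker_toEll, Subgroup.mem_comap, map_commutatorElement]
    exact Subgroup.le_topologicalClosure _ (Subgroup.commutator_mem_commutator hιg hιh)
  intro hbot
  rw [hbot, Subgroup.mem_bot] at hc_ell
  -- so `[g, h] ∈ Ker(Π^tp_X ↠ (Π^tp_X)^Θ) = ι⁻¹ [[Δ_X, Δ_X], Δ_X]⁻`, and `F` kills it
  have hc_theta : ⁅g, h⁆ ∈ D.toTheta.ker := hc_ell
  rw [D.ker_toTheta, Subgroup.mem_comap] at hc_theta
  have key := h3 ⟨D.toHat.toMonoidHom ⁅g, h⁆, hιc⟩ hc_theta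
  rw [dihedral_four_doubleCommutator_eq_bot, Subgroup.mem_bot] at key
  -- but `F (ι [g, h]) = [F ι g, F ι h] = [r, s] ≠ 1`
  have hval : F ⟨D.toHat.toMonoidHom ⁅g, h⁆, hιc⟩ =
      DihedralGroup.r 1 * DihedralGroup.sr 0 * (DihedralGroup.r 1)⁻¹ * (DihedralGroup.sr 0)⁻¹ := by
    have hsub : (⟨D.toHat.toMonoidHom ⁅g, h⁆, hιc⟩ : D.DeltaHat) =
        ⁅(⟨D.toHat.toMonoidHom g, hιg⟩ : D.DeltaHat), ⟨D.toHat.toMonoidHom h, hιh⟩⁆ := by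
      apply Subtype.ext
      simp only [commutatorElement_def, map_mul, map_inv, Subgroup.coe_mul, Subgroup.coe_inv]
    rw [hsub, map_commutatorElement, hFg, hFh, commutatorElement_def]
  rw [hval] at key
  exact dihedral_four_commutator_ne_one key

variable {D} in
/-- **The vacuity guard from its first field**: "`Δ_X` is a profinite free group on 2 generators"
(p. 12) already gives `IsEtThOrigin`. [cite: MochizukiEtTh2009, §1 p.12] -/
theorem IsEtThOrigin.of_free (hfree : IsFreeProfiniteOnTwo D.DeltaHat) : D.IsEtThOrigin :=
  ⟨hfree, D.deltaTheta_ne_bot_of_free hfree⟩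

/-- `IsEtThOrigin D ↔ Δ_X is profinite free on two generators` (p. 12).
[cite: MochizukiEtTh2009, §1 p.12] -/
theorem isEtThOrigin_iff_free : D.IsEtThOrigin ↔ IsFreeProfiniteOnTwo D.DeltaHat :=
  ⟨fun h => h.deltaHat_free, fun h => IsEtThOrigin.of_free h⟩

end ThetaSetting

end Literature.AnabelianGeometry.EtaleTheta
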